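import Summits.NavierStokesRegularity.NavierStokesRegularity.Theses.AxisymmetricExtremality
import Summits.NavierStokesRegularity.NavierStokesRegularity.Theorems.AxisymmetricExtremalityPFoldToAxisymmetric
import Summits.NavierStokesRegularity.NavierStokesRegularity.Theorems.AxisymmetricExtremalityClayDatumCritical
import Summits.NavierStokesRegularity.NavierStokesRegularity.Theorems.AxisymmetricLiouvilleBoundedSwirl
import Summits.NavierStokesRegularity.NavierStokesRegularity.Theorems.AxisymmetricExtremalityAxisymmetricKatoGlobalStubTypeIITransfer
import Literature.Analysis.FluidPDE.NSKatoToClayHolds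
import HarnessLib

/-!
# Strategist s16 — typed candidate statements for the INDEPENDENT strategy census (family `s`)
# of the crux `AxisymmetricExtremality.AxisymmetricKatoGlobal` (stmt-NavierStokesRegularity-15453)

Scratch file of the crux-strategist seat `cstrat-stmt-NavierStokesRegularity-15453-s16` (census
`Cruxes/AxisymmetricKatoGlobal/STRATEGY-CENSUS-s16.md`).  Nothing here is a claim of progress: every
theorem below is LOGIC over the route file and landed tree theorems; every `def … : Prop` is a
CANDIDATE replacement / piece / strengthening that the census examines and rejects, with the reason
recorded in the census.  No `sorry`.

Sections (= census headings):
* § W  — the weakest statement that can stand in the crux's slot of `closes` (`NoAxisymMinimalDatum`),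
  with `closes_of_noAxisymMinimalDatum` (it does stand in) and `noAxisymMinimalDatum_of_crux`; and the
  relative-hardness lemma `summit_iff_minimalDatumPFold_of_W` (given W, the OTHER crux is the summit);
  the perturbative variant `ThresholdCollar` (W′) with `noAxisymMinimalDatum_of_thresholdCollar`.
* § D  — decompositions: the Clay-class bridge `AxisymClayRegular ∧ CriticalTransfer → crux`
  (`axisymClayRegular_of_summit`, `axisymClayRegular_of_crux`: the first piece is a CONJUNCT of the
  summit and a consequence of the crux); the Liouville split
  `AxisymmetricLiouvilleBoundedSwirl ∧ NondegenerateBlowupLimit → crux`.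
* § S⁺ — strengthenings: `LocalAX` (Seregin's local axis-regularity problem in the tree's
  suitable-weak vocabulary), `KatoAxisTypeI` (the unconditional scaled-energy bound at axis points).
* § T  — the common breaking point of the sibling transfers: `SwirlAxisSmallness`.
-/

noncomputable section

set_option linter.dupNamespace false

open Set MeasureTheory Filter Topology Function Metric
open scoped ENNReal NNReal
open Literature.Analysis.FluidPDE Literature.Analysis.FunctionSpaces

namespace Summit.NavierStokesRegularity.NavierStokesRegularity.Cruxes.AxisymmetricKatoGlobal.StrategistS16

open Summit.NavierStokesRegularity.NavierStokesRegularity.Theses.AxisymmetricExtremality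

local notation "ℝ³" => EuclideanSpace ℝ (Fin 3)

/-- The route's unfolded axisymmetry clause (= `IsAxisymmetric u₀`, `Iff.rfl`). -/
def AxisymClause (u₀ : ℝ³ → ℝ³) : Prop :=
  ∀ (θ : ℝ) (x : ℝ³), u₀ (WithLp.toLp 2 ![Real.cos θ * x 0 - Real.sin θ * x 1,
    Real.sin θ * x 0 + Real.cos θ * x 1, x 2]) = WithLp.toLp 2 ![Real.cos θ * u₀ x 0 -
    Real.sin θ * u₀ x 1, Real.sin θ * u₀ x 0 + Real.cos θ * u₀ x 1, u₀ x 2]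

theorem axisymClause_iff (u₀ : ℝ³ → ℝ³) : AxisymClause u₀ ↔ IsAxisymmetric u₀ := Iff.rfl

/-! ## § W — the weakest slot-filler: no axisymmetric MINIMAL blow-up datum -/

/-- **W** («`M ∩ Axisym = ∅`»): for every `ν > 0` no Rusin–Šverák minimal blow-up datum is
axisymmetric.  This is exactly what `closes` consumes from the crux. -/
def NoAxisymMinimalDatum : Prop :=
  ∀ ν : ℝ, 0 < ν → ∀ (u₀ : ℝ³ → ℝ³) (g : HomSobolev ℝ³ (EuclideanSpace ℂ (Fin 3)) (1 / 2 : ℝ)),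
    IsMinimalBlowupDatum ν u₀ g → AxisymClause u₀ → False

/-- The crux implies W (trivial: a minimal datum has no global Kato solution). -/
theorem noAxisymMinimalDatum_of_crux (h : AxisymmetricKatoGlobal) : NoAxisymMinimalDatum := by
  intro ν hν u₀ g hmin hax
  obtain ⟨hL3, hrep, hdiv, -, hnot⟩ := hmin
  exact hnot (h ν hν u₀ g hL3 hrep hdiv hax)

/-- W stands in the crux's slot: the route's deciding theorem with `AxisymmetricKatoGlobal`
replaced by W (same pure-logic proof as `closes`). -/
theorem closes_of_noAxisymMinimalDatum (h₂ : MinimalDatumPFold) (h₄ : PFoldToAxisymmetric)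
    (hW : NoAxisymMinimalDatum) : _root_.NavierStokesRegularity := by
  show Literature.NS.NavierStokesExistenceSmoothR3
  intro ν hν u₀ hsm hdiv hdec
  by_contra hno
  obtain ⟨u₁, g, hmin, hax⟩ := h₄ ν hν (h₂ ν hν ⟨u₀, hsm, hdiv, hdec, hno⟩)
  exact hW ν hν u₁ g hmin hax

/-- **Relative hardness.** Given W (and the PROVED `PFoldToAxisymmetric`), the route's remaining
open crux `MinimalDatumPFold` is EQUIVALENT to the summit.  So replacing the crux by W moves no
difficulty out of the route: W is the whole of what this slot must deliver. -/
theorem summit_iff_minimalDatumPFold_of_W (hW : NoAxisymMinimalDatum) :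
    MinimalDatumPFold ↔ _root_.NavierStokesRegularity :=
  ⟨fun h₂ => closes_of_noAxisymMinimalDatum h₂
      Theorems.axisymmetricExtremality_pFoldToAxisymmetric_proof hW,
    -- the summit implies `MinimalDatumPFold` vacuously (its antecedent is a Clay failure)
    fun hS ν hν hfail => by
      obtain ⟨v₀, hsm, hdiv, hdec, hno⟩ := hfail
      have hS' : Literature.NS.NavierStokesExistenceSmoothR3 := hS
      exact absurd (hS' ν hν v₀ hsm hdiv hdec) hno⟩

/-- **W′** (perturbative weakening: «global regularity is OPEN at the threshold inside the
axisymmetric class»): some `ε`-collar above `ρ_max` of axisymmetric critical data is global.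
By Rusin–Šverák compactness (the route's own proved `PFoldToAxisymmetric` machinery) W′ collapses
back to W, and W′ → W is the trivial direction below; recorded to show that no perturbative
weakening of the slot is genuinely weaker. -/
def ThresholdCollar : Prop :=
  ∀ ν : ℝ, 0 < ν → ∃ ε : ℝ≥0∞, 0 < ε ∧
    ∀ (u₀ : ℝ³ → ℝ³) (g : HomSobolev ℝ³ (EuclideanSpace ℂ (Fin 3)) (1 / 2 : ℝ)),
      MemLp u₀ 3 volume → g.Represents (EuclideanSpace.complexify ∘ u₀) → IsWeaklyDivFree u₀ →
      AxisymClause u₀ → ‖g‖ₑ < rusinSverakRhoMaxPure ν + ε → HasGlobalKatoSolution ν u₀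

theorem noAxisymMinimalDatum_of_thresholdCollar (h : ThresholdCollar) : NoAxisymMinimalDatum := by
  intro ν hν u₀ g hmin hax
  obtain ⟨ε, hε, hcol⟩ := h ν hν
  obtain ⟨hL3, hrep, hdiv, hnorm, hnot⟩ := hmin
  refine hnot (hcol u₀ g hL3 hrep hdiv hax ?_)
  rw [← hnorm]
  exact ENNReal.lt_add_right enorm_ne_top hε.ne'

/-! ## § D — decompositions -/

/-- **S_ax**: the summit (Clay (A), `Literature.NS.NavierStokesExistenceSmoothR3`) RESTRICTED to
axisymmetric data — the axisymmetric-with-swirl regularity problem in Clay vocabulary (cf. the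
conjecture leaf `AxisymmetricSwirlRegularity`, ns.S25, which uses `IsClassicalNSSolutionOn`). -/
def AxisymClayRegular : Prop :=
  ∀ ν : ℝ, 0 < ν → ∀ u₀ : ℝ³ → ℝ³, ContDiff ℝ (⊤ : ℕ∞) u₀ → NSWave0.IsDivFree u₀ →
    HasRapidSpatialDecay u₀ → AxisymClause u₀ →
      ∃ (u : ℝ → ℝ³ → ℝ³) (p : ℝ → ℝ³ → ℝ),
        IsSmoothOnHalfSpace u ∧ IsSmoothOnHalfSpace p ∧ IsNavierStokesSolution ν 0 u₀ u p ∧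
          HasBoundedEnergy u

/-- S_ax is a CONJUNCT of the summit (restriction). -/
theorem axisymClayRegular_of_summit (hS : _root_.NavierStokesRegularity) : AxisymClayRegular := by
  intro ν hν u₀ hsm hdiv hdec _hax
  have hS' : Literature.NS.NavierStokesExistenceSmoothR3 := hS
  exact hS' ν hν u₀ hsm hdiv hdec

/-- S_ax is a CONSEQUENCE of the crux (Clay data are critical data — PROVED `ClayDatumCritical`;
Kato-global ⇒ Clay solution — PROVED `clay_solution_of_hasGlobalKatoSolution_holds`). -/
theorem axisymClayRegular_of_crux (h : AxisymmetricKatoGlobal) : AxisymClayRegular := by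
  intro ν hν u₀ hsm hdiv hdec hax
  obtain ⟨hL3, hwdiv, g, hrep⟩ :=
    Theorems.axisymmetricExtremality_clayDatumCritical_proof u₀ hsm hdiv hdec
  exact clay_solution_of_hasGlobalKatoSolution_holds ν hν u₀ hsm hdiv hdec
    (h ν hν u₀ g hL3 hrep hwdiv hax)

/-- **T** (the Schwartz-to-critical transfer): Clay-class axisymmetric regularity ⇒ the crux. -/
def CriticalTransfer : Prop := AxisymClayRegular → AxisymmetricKatoGlobal

/-- The bridge split assembles by modus ponens (a `trivial_seam`; the content is in the pieces). -/
theorem crux_of_bridge (h₁ : AxisymClayRegular) (h₂ : CriticalTransfer) : AxisymmetricKatoGlobal :=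
  h₂ h₁

/-- **N** (non-degenerate blow-up limit): an axisymmetric critical datum WITHOUT a global Kato
solution produces, by some rescaling, a bounded ancient mild solution (unit viscosity) that is
axisymmetric with bounded swirl and is NOT a.e. constant on every time slice.  (KNSS 2009 /
Seregin–Šverák 2009 obtain such a limit only under a Type I rate; without it the sup-normalised
limit may be a constant flow, and in the off-axis case it IS constant by the 2D Liouville theorem.) -/
def NondegenerateBlowupLimit : Prop :=
  ∀ ν : ℝ, 0 < ν → ∀ (u₀ : ℝ³ → ℝ³) (g : HomSobolev ℝ³ (EuclideanSpace ℂ (Fin 3)) (1 / 2 : ℝ)),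
    MemLp u₀ 3 volume → g.Represents (EuclideanSpace.complexify ∘ u₀) → IsWeaklyDivFree u₀ →
    AxisymClause u₀ → ¬ HasGlobalKatoSolution ν u₀ →
      ∃ U : ℝ → ℝ³ → ℝ³, IsBoundedAncientMildSolution 1 U ∧
        (∀ t < 0, AEStronglyMeasurable (U t) volume) ∧ (∀ t < 0, IsAxisymmetric (U t)) ∧
        (∃ C : ℝ, ∀ t < 0, ∀ x, |swirl (U t) x| ≤ C) ∧
        ¬ ∀ t < 0, ∃ b : ℝ³, U t =ᵐ[volume] fun _ => b

/-- The Liouville split assembles (pure logic): AX-L kills every non-degenerate limit. -/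
theorem crux_of_liouville_split (hL : AxisymmetricLiouvilleBoundedSwirl)
    (hN : NondegenerateBlowupLimit) : AxisymmetricKatoGlobal := by
  intro ν hν u₀ g hL3 hrep hdiv hax
  by_contra hno
  obtain ⟨U, hanc, hmeas, haxU, hsw, hnc⟩ := hN ν hν u₀ g hL3 hrep hdiv hax hno
  exact hnc (hL U hanc hmeas haxU hsw)

/-! ## § S⁺ — strengthenings -/

/-- **LOCAL-AX** (Seregin's local problem, slab form in the tree's vocabulary = the landed
`EulerScaling.stub_typeII_transfer` with BOTH its Seregin-fact hypothesis and its rate hypothesis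
`limsup C(r) < ∞` deleted): a suitable weak solution on `(0,T) × ℝ³`, smooth inside with
axisymmetric slices and local energy classes up to `T`, is bounded near every axis point at time
`T`.  Strictly stronger than the crux (no datum, no globality); the open local regularity problem. -/
def LocalAX : Prop :=
  ∀ ν : ℝ, 0 < ν → ∀ T : ℝ, 0 < T → ∀ (u : ℝ → ℝ³ → ℝ³) (p : ℝ → ℝ³ → ℝ),
    ContDiffOn ℝ (⊤ : ℕ∞) (uncurry u) (Ioo 0 T ×ˢ univ) →
    (∀ t ∈ Ioo 0 T, IsAxisymmetric (u t)) →
    (∀ t ∈ Ioo 0 T, IsAxisymmetricScalar (p t)) →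
    IsSuitableWeakSolutionOn (slab ℝ³ (Ioo 0 T) isOpen_Ioo) ν 0 u p →
    (∀ t₁ ∈ Ioo 0 T, ∀ ρ : ℝ, 0 < ρ →
        (∃ C : ℝ≥0, ∀ t ∈ Ioo t₁ T, ∫⁻ x in ball (0 : ℝ³) ρ, ‖u t x‖ₑ ^ 2 ≤ C) ∧
        (∫⁻ z in Ioo t₁ T ×ˢ ball (0 : ℝ³) ρ,
            ENNReal.ofReal (frobeniusNormSq (fderiv ℝ (u z.1) z.2)) < ∞) ∧
        (∫⁻ z in Ioo t₁ T ×ˢ ball (0 : ℝ³) ρ, ‖p z.1 z.2‖ₑ ^ (3 / 2 : ℝ) < ∞)) →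
    ∀ x₀ : ℝ³, cylRadius x₀ = 0 → IsBoundedNearTop u T x₀

/-- **KATO-AXIS-TYPE-I** (the a-priori scaled-energy bound at axis points, unconditional): for an
axisymmetric Kato solution on `(0,T)`, `limsup_{r→0} r⁻² ∫_{Q_r(T,x₀)} |u|³ < ∞` at every axis point.
It is the common conclusion of the registered stubs 4 ∧ 5 of line `euler-scaling` with their rate
hypotheses deleted, hence implies both (and the crux, by the line's kernel-checked composition);
conversely the crux implies it (a global smooth solution is bounded near `(T,x₀)`), so it is the
crux re-expressed as an a-priori estimate, not a strengthening with new structure. -/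
def KatoAxisTypeI : Prop :=
  ∀ ν : ℝ, 0 < ν → ∀ T : ℝ, 0 < T → ∀ (u₀ : ℝ³ → ℝ³)
    (g : HomSobolev ℝ³ (EuclideanSpace ℂ (Fin 3)) (1 / 2 : ℝ)) (u : ℝ → ℝ³ → ℝ³),
    g.Represents (EuclideanSpace.complexify ∘ u₀) →
    IsKatoSolutionOn T ν u₀ u → ContDiffOn ℝ (⊤ : ℕ∞) (uncurry u) (Ioo 0 T ×ˢ univ) →
    (∀ t ∈ Ioo 0 T, IsAxisymmetric (u t)) →
    ∀ x₀ : ℝ³, cylRadius x₀ = 0 →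
      limsup (fun r => cknC r ((T, x₀) : ℝ × ℝ³) u) (𝓝[>] 0) < ∞

/-! ## § T — the common breaking point of the sibling transfers -/

/-- **Swirl smallness at the axis up to the top time** (the input at which the no-swirl /
2D-Boussinesq / Chen–Fang–Zhang–Lei–Zhang–Wei transfers all break: the source `∂_z Γ² / r⁴` in the
`ω_θ / r` equation is absorbed only where `Γ = r u_θ` is SMALL near the axis): for an axisymmetric
Kato solution smooth on `(0,T) × ℝ³`, on every `[t₀,T)` the swirl tends to `0` at the axis
uniformly.  A consequence of the crux (continuity of a global smooth `Γ`, which vanishes on the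
axis); weaker than the registered `stub_swirlAxisModulus` (which asks the rate `C/|log r|³`); not
known to imply regularity (the printed criteria need a log-rate), and itself open. -/
def SwirlAxisSmallness : Prop :=
  ∀ ν : ℝ, 0 < ν → ∀ T : ℝ, 0 < T → ∀ (u₀ : ℝ³ → ℝ³) (u : ℝ → ℝ³ → ℝ³),
    IsKatoSolutionOn T ν u₀ u → ContDiffOn ℝ (⊤ : ℕ∞) (uncurry u) (Ioo 0 T ×ˢ univ) →
    (∀ t ∈ Ioo 0 T, IsAxisymmetric (u t)) →
    ∀ t₀ ∈ Ioo 0 T, ∀ ε : ℝ, 0 < ε → ∃ δ : ℝ, 0 < δ ∧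
      ∀ t ∈ Ico t₀ T, ∀ x : ℝ³, cylRadius x ≤ δ → |swirl (u t) x| ≤ ε

end Summit.NavierStokesRegularity.NavierStokesRegularity.Cruxes.AxisymmetricKatoGlobal.StrategistS16

end
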